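import Literature.Computability.Complexity.CircuitComposition
import Literature.Computability.Complexity.HardnessVsRandomness
import HarnessLib

/-!
# Fooled circuits may ignore inputs: small tests on a prefix of a pseudorandom string
# (IKW 2002, §2.4, footnote 2; toolkit for the proof of IKW Thm. 12)

Literature / circuit complexity — derandomization, companion of `HardnessVsRandomness.lean`
(`Fools G S ε`, `IsSizePseudorandom G`, `tableGenerator`). Impagliazzo–Kabanets–Wigderson define
`SIZE(n)`-pseudorandomness of `G : {0,1}^{l(n)} → {0,1}ⁿ` against "any `n`-input Boolean circuit `C`
of size `n`" with the footnote "such a circuit `C` may not use some of its `n` inputs" (§2.4,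
footnote 2). In the proof of their Theorem 12 (`IKWGenerators.lean`) the fooled test is Arthur's
predicate `z ↦ R(x, y, z)` on `m = poly(|x|)` random bits, read off the FIRST `m ≤ n` output bits of
the generator. This file proves that form of the definition, over the tree's multi-output circuit
toolkit `CktSize` (`CircuitComposition.lean`):

* `card_filter_comp_castLE`, `card_filter_comp_castLE_div` — restricting a uniform `u ∈ {0,1}ⁿ` to
  its first `m ≤ n` coordinates is uniform (`#{u | P (u|_m)} = 2^{n-m} · #{v | P v}`);
* **`Fools.abs_sub_le_of_cktSize`** — if `G : {0,1}ᵏ → {0,1}ⁿ` fools size `S` with error `ε`,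
  `m ≤ n`, and `D : {0,1}^m → {0,1}` has `B₂`-circuits with at most `S` gates, then
  `|Pr_s[D(G(s)|_m) = 1] − Pr_{z ∈ {0,1}^m}[D(z) = 1]| ≤ ε` (view `D` as an `n`-input circuit reading
  only its first `m` inputs: `CktSize.rewire`, `CktSize.toCircuit`); the one-sided forms
  `Fools.sub_le_of_cktSize` (completeness of the derandomized Arthur: at most `ε` of the acceptance
  probability is lost) and `Fools.le_add_of_cktSize` (soundness: at most `ε` is gained), and the
  `IsSizePseudorandom` specialisations (`S = n`, `ε = 1/n`).

Everything is proved; no definitions. Mathlib has no pseudorandomness against circuits; nothing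
here duplicates the tree (searched `castLE`, `Fools`, `abs_sub_le`, `prgAdvantage`: only
`Fools.abs_sub_le` of `HardnessVsRandomness.lean`, the case `m = n` for a literal circuit).

## References

* R. Impagliazzo, V. Kabanets, A. Wigderson, *In search of an easy witness: exponential time vs.
  probabilistic polynomial time*, J. Comput. System Sci. 65 (2002) 672–694, §2.4 and footnote 2,
  Thm. 12 [ImpagliazzoKabanetsWigderson2002] (held text `paper:doi-10-1016-s0022-0000-02-00024-7`,
  pp. 7–8, checked).
* S. Arora, B. Barak, *Computational Complexity: A Modern Approach*, CUP 2009, Def. 20.2 and the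
  proof of Lemma 20.20 (Arthur's predicate as the distinguisher) [AroraBarakCC2009].
* H. Vollmer, *Introduction to Circuit Complexity*, Springer 1999, §1.1 (projections cost no
  gates) [Vollmer1999].
-/

noncomputable section

namespace Literature.Computability.Complexity

open _root_.Computability Finset MetaComplexity

/-! ### Restricting a uniform string to a prefix of its coordinates -/

/-- Restricting a uniform `u ∈ {0,1}ⁿ` to its first `m ≤ n` coordinates is uniform: every
`v ∈ {0,1}^m` has exactly `2^{n-m}` extensions, so `#{u | P (u|_m)} = 2^{n-m} · #{v | P v}`.
[folklore] -/
theorem card_filter_comp_castLE {m n : ℕ} (h : m ≤ n) (P : (Fin m → Bool) → Prop)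
    [DecidablePred P] :
    (univ.filter fun u : Fin n → Bool => P fun j => u (Fin.castLE h j)).card =
      2 ^ (n - m) * (univ.filter P).card := by
  classical
  -- split the coordinates `Fin n ≃ Fin m ⊕ Fin (n - m)`
  let e₁ : Fin n ≃ Fin m ⊕ Fin (n - m) := (finCongr (by omega)).trans finSumFinEquiv.symm
  let e : (Fin n → Bool) ≃ (Fin m → Bool) × (Fin (n - m) → Bool) :=
    (Equiv.arrowCongr e₁ (Equiv.refl Bool)).trans (Equiv.sumArrowEquivProdArrow _ _ _)
  have he : ∀ u : Fin n → Bool, (e u).1 = fun j => u (Fin.castLE h j) := by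
    intro u
    funext j
    simp only [e, e₁, Equiv.trans_apply, Equiv.sumArrowEquivProdArrow_apply_fst,
      Equiv.arrowCongr_apply, Equiv.coe_refl, Function.comp_apply, Equiv.symm_trans_apply,
      Equiv.symm_symm, finSumFinEquiv_apply_left, finCongr_symm, finCongr_apply, id_eq]
    rfl
  have h1 : (univ.filter fun u : Fin n → Bool => P fun j => u (Fin.castLE h j)).card =
      (univ.filter fun p : (Fin m → Bool) × (Fin (n - m) → Bool) => P p.1).card := by
    refine card_bij (fun u _ => e u) (fun u hu => ?_) (fun u₁ _ u₂ _ huu => e.injective huu)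
      (fun p hp => ⟨e.symm p, ?_, e.apply_symm_apply p⟩)
    · simp only [mem_filter, mem_univ, true_and] at hu ⊢
      rwa [he]
    · simp only [mem_filter, mem_univ, true_and] at hp ⊢
      rw [← he (e.symm p), e.apply_symm_apply]
      exact hp
  rw [h1]
  have h2 : (univ.filter fun p : (Fin m → Bool) × (Fin (n - m) → Bool) => P p.1) =
      (univ.filter P) ×ˢ (univ : Finset (Fin (n - m) → Bool)) := by
    ext p
    simp
  rw [h2, card_product, card_univ, Fintype.card_pi_const, Fintype.card_bool, mul_comm]

/-- The uniform probability of a test on the first `m ≤ n` coordinates of `u ∈ {0,1}ⁿ` equals its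
probability over `{0,1}^m`. [folklore] -/
theorem card_filter_comp_castLE_div {m n : ℕ} (h : m ≤ n) (P : (Fin m → Bool) → Prop)
    [DecidablePred P] :
    ((univ.filter fun u : Fin n → Bool => P fun j => u (Fin.castLE h j)).card : ℝ) / 2 ^ n =
      ((univ.filter P).card : ℝ) / 2 ^ m := by
  rw [card_filter_comp_castLE h P, Nat.cast_mul, Nat.cast_pow, Nat.cast_ofNat,
    div_eq_div_iff (by positivity) (by positivity)]
  rw [mul_assoc, mul_comm ((univ.filter P).card : ℝ), ← mul_assoc, ← pow_add,
    Nat.sub_add_cancel h, mul_comm]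

/-! ### Fooled tests on a prefix of the output -/

variable {k n m s S : ℕ} {ε : ℝ} {G : (Fin k → Bool) → (Fin n → Bool)} {D : (Fin m → Bool) → Bool}

/-- **A fooled circuit may ignore inputs** (IKW §2.4, footnote 2: "such a circuit `C` may not use
some of its `n` inputs"). If `G : {0,1}ᵏ → {0,1}ⁿ` fools size `S` with error `ε`, `m ≤ n`, and the
test `D : {0,1}^m → {0,1}` has `B₂`-circuits with at most `S` gates (`CktSize`), then `D` applied to
the first `m` output bits is fooled: `|Pr_s[D(G(s)|_m) = 1] − Pr_{z ∈ {0,1}^m}[D(z) = 1]| ≤ ε` (the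
rewired `n`-input circuit has the same gates, `CktSize.rewire`/`CktSize.toCircuit`, and restriction
of a uniform string is uniform, `card_filter_comp_castLE_div`).
[cite: ImpagliazzoKabanetsWigderson2002, §2.4] -/
theorem Fools.abs_sub_le_of_cktSize (hG : Fools G S ε) (hmn : m ≤ n)
    (hD : CktSize B2 (fun z (_ : Unit) => D z) s) (hs : s ≤ S) :
    |((univ.filter fun z : Fin k → Bool => D (fun j => G z (Fin.castLE hmn j)) = true).card : ℝ) /
          2 ^ k -
        ((univ.filter fun v : Fin m → Bool => D v = true).card : ℝ) / 2 ^ m| ≤ ε := by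
  obtain ⟨C, hCB, hCs, hCe⟩ := (hD.rewire (ι' := Fin n) (Fin.castLE hmn)).toCircuit
  have hadv := hG C hCB (hCs.trans hs)
  unfold prgAdvantage at hadv
  have e1 : (univ.filter fun s : Fin k → Bool => C.eval (G s) = true) =
      univ.filter fun z : Fin k → Bool => D (fun j => G z (Fin.castLE hmn j)) = true := by
    ext z
    simp [hCe]
  have e2 : ((univ.filter fun y : Fin n → Bool => C.eval y = true).card : ℝ) / 2 ^ n =
      ((univ.filter fun v : Fin m → Bool => D v = true).card : ℝ) / 2 ^ m := by
    have hf : (univ.filter fun y : Fin n → Bool => C.eval y = true) =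
        univ.filter fun u : Fin n → Bool => D (fun j => u (Fin.castLE hmn j)) = true := by
      ext y
      simp [hCe]
    rw [hf]
    exact card_filter_comp_castLE_div hmn (fun v : Fin m → Bool => D v = true)
  rwa [e1, e2] at hadv

/-- Completeness direction: a fooled test loses at most `ε` of its acceptance probability on
pseudorandom inputs, `Pr_z[D z] − ε ≤ Pr_s[D(G(s)|_m)]` (the derandomized Arthur still accepts a
good proof of Merlin). [cite: ImpagliazzoKabanetsWigderson2002, §2.4] -/
theorem Fools.sub_le_of_cktSize (hG : Fools G S ε) (hmn : m ≤ n)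
    (hD : CktSize B2 (fun z (_ : Unit) => D z) s) (hs : s ≤ S) :
    ((univ.filter fun v : Fin m → Bool => D v = true).card : ℝ) / 2 ^ m - ε ≤
      ((univ.filter fun z : Fin k → Bool => D (fun j => G z (Fin.castLE hmn j)) = true).card : ℝ) /
        2 ^ k := by
  have := hG.abs_sub_le_of_cktSize hmn hD hs
  rw [abs_sub_le_iff] at this
  linarith [this.2]

/-- Soundness direction: a fooled test gains at most `ε`, `Pr_s[D(G(s)|_m)] ≤ Pr_z[D z] + ε` (the
derandomized Arthur is not cheated by any proof of Merlin). [cite: ImpagliazzoKabanetsWigderson2002, §2.4] -/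
theorem Fools.le_add_of_cktSize (hG : Fools G S ε) (hmn : m ≤ n)
    (hD : CktSize B2 (fun z (_ : Unit) => D z) s) (hs : s ≤ S) :
    ((univ.filter fun z : Fin k → Bool => D (fun j => G z (Fin.castLE hmn j)) = true).card : ℝ) /
        2 ^ k ≤
      ((univ.filter fun v : Fin m → Bool => D v = true).card : ℝ) / 2 ^ m + ε := by
  have := hG.abs_sub_le_of_cktSize hmn hD hs
  rw [abs_sub_le_iff] at this
  linarith [this.1]

/-- `SIZE(n)`-pseudorandom generators fool small tests on a prefix within `1/n` (the form in which
IKW Thm. 11 is used in the proof of IKW Thm. 12). [cite: ImpagliazzoKabanetsWigderson2002, §2.4] -/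
theorem IsSizePseudorandom.abs_sub_le_of_cktSize (hG : IsSizePseudorandom G) (hmn : m ≤ n)
    (hD : CktSize B2 (fun z (_ : Unit) => D z) s) (hs : s ≤ n) :
    |((univ.filter fun z : Fin k → Bool => D (fun j => G z (Fin.castLE hmn j)) = true).card : ℝ) /
          2 ^ k -
        ((univ.filter fun v : Fin m → Bool => D v = true).card : ℝ) / 2 ^ m| ≤ 1 / (n : ℝ) :=
  Fools.abs_sub_le_of_cktSize hG hmn hD hs

/-- Completeness with a `SIZE(n)`-pseudorandom generator: `Pr_z[D z] − 1/n ≤ Pr_s[D(G(s)|_m)]`.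
[cite: ImpagliazzoKabanetsWigderson2002, §2.4] -/
theorem IsSizePseudorandom.sub_le_of_cktSize (hG : IsSizePseudorandom G) (hmn : m ≤ n)
    (hD : CktSize B2 (fun z (_ : Unit) => D z) s) (hs : s ≤ n) :
    ((univ.filter fun v : Fin m → Bool => D v = true).card : ℝ) / 2 ^ m - 1 / (n : ℝ) ≤
      ((univ.filter fun z : Fin k → Bool => D (fun j => G z (Fin.castLE hmn j)) = true).card : ℝ) /
        2 ^ k :=
  Fools.sub_le_of_cktSize hG hmn hD hs

/-- Soundness with a `SIZE(n)`-pseudorandom generator: `Pr_s[D(G(s)|_m)] ≤ Pr_z[D z] + 1/n`.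
[cite: ImpagliazzoKabanetsWigderson2002, §2.4] -/
theorem IsSizePseudorandom.le_add_of_cktSize (hG : IsSizePseudorandom G) (hmn : m ≤ n)
    (hD : CktSize B2 (fun z (_ : Unit) => D z) s) (hs : s ≤ n) :
    ((univ.filter fun z : Fin k → Bool => D (fun j => G z (Fin.castLE hmn j)) = true).card : ℝ) /
        2 ^ k ≤
      ((univ.filter fun v : Fin m → Bool => D v = true).card : ℝ) / 2 ^ m + 1 / (n : ℝ) :=
  Fools.le_add_of_cktSize hG hmn hD hs

end Literature.Computability.Complexity

end
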